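import Summits.QuantumAdvantage.QuantumAdvantage.Theorems.NearExactIsExact.Negative.BqqSeven
import Summits.QuantumAdvantage.QuantumAdvantage.Theorems.NearExactIsExact.Negative.CentroidMoments

/-!
# `NearExactIsExact` (stmt-QuantumAdvantage-14043) — negative-side tool: the D-orthogonality PRODUCT TEST, all `s`

The Maiorana–McFarland 31/32 habitat "BQ-s" of the crux (b2b cell, DISPROOF §10.4, §24, §27): `π` a permutation of
`𝔽₂ˢ` with `π` and `τ = π⁻¹` coordinatewise quadratic, `c₁, c₂` cubic, residual word `r = c₁ ⊕ c₂∘π`; the MM cubic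
pair built on them at `n = 2s` has `Φ = 1 − 2·wt(r)/2ˢ`. Every structural statement about the support of `r`
(the `s = 11` normal form of §10.4(b), LEMMA S12 of §24.8, LEMMA S13 of §27) starts from the PRODUCT TEST proved here
once and for all `s`:

* `productTest`: for `p` of degree `≤ d₁` and `q` of degree `≤ d₂` with `3 + d₁ + 2d₂ < s` and `3 + d₂ + 2d₁ < s`,
  the set `{y : r(y) = 1, p(y) = 1, q(π y) = 1}` has EVEN size. Proof: `r·p·(q∘π) = c₁·p·(q∘π) ⊕ ((c₂·q·(p∘τ))∘π)`;
  the first function has degree `≤ 3 + d₁ + 2d₂ < s`, the second is the `π`-pullback of a function of degree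
  `≤ 3 + d₂ + 2d₁ < s`; a Boolean function of degree `< s` on `s` bits has even weight
  (`natCast_card_eq_zero_of_isDegLeFun`), and pullback by a bijection preserves weight (`bq_card_filter_comp`).
* `productTest_support`: the same with `r` replaced by any `U` with `c₁ ⊕ c₂∘π = U` pointwise (e.g. a flat indicator):
  `Σ_{y ∈ U} p(y) q(π y) ≡ 0 (mod 2)` — by Reed–Muller duality on `U` this is "`(q∘π)|_U` has degree
  `≤ dim U − 1 − d₁`", the form in which §24.4 / §27.2 use it.
* the three instances at `s = 13` behind LEMMA S13 (`(d₁,d₂) = (4,1), (3,2), (3,3)`): `productTest_thirteen_41/32/33`.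

`bq_par` (file `BqqSeven`) is the case `s = 7`, `d₁ = d₂ = 1`; the proof below is its verbatim generalisation.
HONEST FRAMING: infrastructure for THEOREMS about one habitat of the crux (kernel-checked), NOT summit progress.
Sources (orientation only): F. J. MacWilliams, N. J. A. Sloane, The Theory of Error-Correcting Codes (1977) Ch. 13
(Reed–Muller codes, weights and duals); everything used is proved in the tree; standard axioms.
-/

set_option linter.dupNamespace false -- D-0017: single-problem summit ⇒ `QuantumAdvantage.QuantumAdvantage` by design

namespace Summit.QuantumAdvantage.QuantumAdvantage.Theorems.NearExactIsExact.Negative.ProductTest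

open Finset
open Literature.Computability.QuantumComplexity
open Summit.QuantumAdvantage.QuantumAdvantage.Theorems.CubicForrelation.NearExactIsExact
  (fc_isDegLeFun_comp te_isDegLeFun_band erm_even_card_xor)
open Summit.QuantumAdvantage.QuantumAdvantage.Theorems.NearExactIsExact.Negative.BqqSeven (bq_card_filter_comp)
open Summit.QuantumAdvantage.QuantumAdvantage.Theorems.NearExactIsExact.Negative.CentroidMoments
  (natCast_card_eq_zero_of_isDegLeFun)

/-- A Boolean function of algebraic degree `d < s` on `s` bits takes the value `true` an even number of times
(the coefficient of the top monomial `x₁⋯x_s` is the parity of the weight). [folklore] -/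
theorem even_card_of_deg_lt {s d : ℕ} {F : (Fin s → Bool) → Bool} (hF : IsDegLeFun d F) (hd : d < s) :
    Even #(univ.filter fun y : Fin s → Bool => F y = true) :=
  ZMod.natCast_eq_zero_iff_even.1 (natCast_card_eq_zero_of_isDegLeFun hF hd)

/-- **PRODUCT TEST** (D-orthogonality, all `s`). For mutually inverse coordinatewise-quadratic maps `π, τ` of `𝔽₂ˢ`,
cubic `c₁, c₂`, and `p, q` of degrees `≤ d₁, ≤ d₂` with `3 + d₁ + 2d₂ < s` and `3 + d₂ + 2d₁ < s`, the number of
`y` with `c₁(y) ≠ c₂(π y)`, `p(y) = 1`, `q(π y) = 1` is even. [folklore] -/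
theorem productTest {s d₁ d₂ : ℕ} (π τ : (Fin s → Bool) → (Fin s → Bool))
    (hπ : ∀ i, IsDegLeFun 2 (fun y => π y i)) (hτ : ∀ i, IsDegLeFun 2 (fun x => τ x i))
    (hτπ : ∀ y, τ (π y) = y) (hπτ : ∀ x, π (τ x) = x)
    (c₁ c₂ : (Fin s → Bool) → Bool) (h₁ : IsDegLeFun 3 c₁) (h₂ : IsDegLeFun 3 c₂)
    (p q : (Fin s → Bool) → Bool) (hp : IsDegLeFun d₁ p) (hq : IsDegLeFun d₂ q)
    (hs₁ : 3 + d₁ + 2 * d₂ < s) (hs₂ : 3 + d₂ + 2 * d₁ < s) :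
    Even #(univ.filter fun y : Fin s → Bool => ((c₁ y ^^ c₂ (π y)) && (p y && q (π y))) = true) := by
  have hbij : Function.Bijective π :=
    ⟨fun a b hab => by rw [← hτπ a, ← hτπ b, hab], fun x => ⟨τ x, hπτ x⟩⟩
  -- split the xor: `r·p·(q∘π) = c₁ p (q∘π) ⊕ (c₂ q (p∘τ))∘π`
  have e : ∀ y : Fin s → Bool, ((c₁ y ^^ c₂ (π y)) && (p y && q (π y))) =
      ((c₁ y && (p y && q (π y))) ^^ (c₂ (π y) && (p (τ (π y)) && q (π y)))) := by
    intro y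
    rw [hτπ y]
    cases c₁ y <;> cases c₂ (π y) <;> cases p y <;> cases q (π y) <;> rfl
  simp_rw [e]
  refine erm_even_card_xor _ _ (Even.add ?_ ?_)
  · -- degree of `c₁ · p · (q ∘ π)` is ≤ 3 + (d₁ + 2 d₂) < s
    have hqπ : IsDegLeFun (2 * d₂) (fun y : Fin s → Bool => q (π y)) :=
      fc_isDegLeFun_comp hq π hπ le_rfl
    refine even_card_of_deg_lt (te_isDegLeFun_band h₁ (te_isDegLeFun_band hp hqπ)) ?_
    omega
  · -- reindex by `π`, then degree of `c₂ · (p ∘ τ) · q` is ≤ 3 + (2 d₁ + d₂) < s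
    rw [bq_card_filter_comp π hbij (fun x => c₂ x && (p (τ x) && q x))]
    have hpτ : IsDegLeFun (2 * d₁) (fun x : Fin s → Bool => p (τ x)) :=
      fc_isDegLeFun_comp hp τ hτ le_rfl
    refine even_card_of_deg_lt (te_isDegLeFun_band h₂ (te_isDegLeFun_band hpτ hq)) ?_
    omega

/-- **PRODUCT TEST on the support.** If `c₁ ⊕ c₂∘π = U` pointwise (in BQ-s: `U` the indicator of the residual
flat), then `#{y ∈ U : p(y) ∧ q(π y)}` is even for all test pairs `(p, q)` as in `productTest`; by Reed–Muller
duality on the flat this says `deg (q∘π)|_U ≤ dim U − 1 − d₁` (DISPROOF §24.4, §27.2). [folklore] -/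
theorem productTest_support {s d₁ d₂ : ℕ} (π τ : (Fin s → Bool) → (Fin s → Bool))
    (hπ : ∀ i, IsDegLeFun 2 (fun y => π y i)) (hτ : ∀ i, IsDegLeFun 2 (fun x => τ x i))
    (hτπ : ∀ y, τ (π y) = y) (hπτ : ∀ x, π (τ x) = x)
    (c₁ c₂ U : (Fin s → Bool) → Bool) (h₁ : IsDegLeFun 3 c₁) (h₂ : IsDegLeFun 3 c₂)
    (hU : ∀ y, (c₁ y ^^ c₂ (π y)) = U y)
    (p q : (Fin s → Bool) → Bool) (hp : IsDegLeFun d₁ p) (hq : IsDegLeFun d₂ q)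
    (hs₁ : 3 + d₁ + 2 * d₂ < s) (hs₂ : 3 + d₂ + 2 * d₁ < s) :
    Even #(univ.filter fun y : Fin s → Bool => (U y && (p y && q (π y))) = true) := by
  have h := productTest π τ hπ hτ hτπ hπτ c₁ c₂ h₁ h₂ p q hp hq hs₁ hs₂
  simp_rw [hU] at h
  exact h

/-- The instance `s = 13`, `(d₁, d₂) = (4, 1)` of `productTest_support`: with `p` quartic and `q` AFFINE — by RM duality
on the 7-flat `U`, every component of `π|_U` has degree `≤ 2` (hypothesis (V1) of LEMMA S13, DISPROOF §27.2). [folklore] -/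
theorem productTest_thirteen_41 (π τ : (Fin 13 → Bool) → (Fin 13 → Bool))
    (hπ : ∀ i, IsDegLeFun 2 (fun y => π y i)) (hτ : ∀ i, IsDegLeFun 2 (fun x => τ x i))
    (hτπ : ∀ y, τ (π y) = y) (hπτ : ∀ x, π (τ x) = x)
    (c₁ c₂ U : (Fin 13 → Bool) → Bool) (h₁ : IsDegLeFun 3 c₁) (h₂ : IsDegLeFun 3 c₂)
    (hU : ∀ y, (c₁ y ^^ c₂ (π y)) = U y)
    (p q : (Fin 13 → Bool) → Bool) (hp : IsDegLeFun 4 p) (hq : IsDegLeFun 1 q) :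
    Even #(univ.filter fun y : Fin 13 → Bool => (U y && (p y && q (π y))) = true) :=
  productTest_support π τ hπ hτ hτπ hπτ c₁ c₂ U h₁ h₂ hU p q hp hq (by norm_num) (by norm_num)

/-- The instance `s = 13`, `(d₁, d₂) = (3, 2)`: `p` cubic, `q` QUADRATIC — pairwise products of components of `π|_U`
have degree `≤ 3` on the 7-flat (hypothesis (V3) of LEMMA S13). [folklore] -/
theorem productTest_thirteen_32 (π τ : (Fin 13 → Bool) → (Fin 13 → Bool))
    (hπ : ∀ i, IsDegLeFun 2 (fun y => π y i)) (hτ : ∀ i, IsDegLeFun 2 (fun x => τ x i))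
    (hτπ : ∀ y, τ (π y) = y) (hπτ : ∀ x, π (τ x) = x)
    (c₁ c₂ U : (Fin 13 → Bool) → Bool) (h₁ : IsDegLeFun 3 c₁) (h₂ : IsDegLeFun 3 c₂)
    (hU : ∀ y, (c₁ y ^^ c₂ (π y)) = U y)
    (p q : (Fin 13 → Bool) → Bool) (hp : IsDegLeFun 3 p) (hq : IsDegLeFun 2 q) :
    Even #(univ.filter fun y : Fin 13 → Bool => (U y && (p y && q (π y))) = true) :=
  productTest_support π τ hπ hτ hτπ hπτ c₁ c₂ U h₁ h₂ hU p q hp hq (by norm_num) (by norm_num)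

/-- The instance `s = 13`, `(d₁, d₂) = (3, 3)`: `p` cubic, `q` CUBIC — triple products of components of `π|_U` have
degree `≤ 3` on the 7-flat (hypothesis (V4) of LEMMA S13, the one that kills the half-affine placements). [folklore] -/
theorem productTest_thirteen_33 (π τ : (Fin 13 → Bool) → (Fin 13 → Bool))
    (hπ : ∀ i, IsDegLeFun 2 (fun y => π y i)) (hτ : ∀ i, IsDegLeFun 2 (fun x => τ x i))
    (hτπ : ∀ y, τ (π y) = y) (hπτ : ∀ x, π (τ x) = x)
    (c₁ c₂ U : (Fin 13 → Bool) → Bool) (h₁ : IsDegLeFun 3 c₁) (h₂ : IsDegLeFun 3 c₂)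
    (hU : ∀ y, (c₁ y ^^ c₂ (π y)) = U y)
    (p q : (Fin 13 → Bool) → Bool) (hp : IsDegLeFun 3 p) (hq : IsDegLeFun 3 q) :
    Even #(univ.filter fun y : Fin 13 → Bool => (U y && (p y && q (π y))) = true) :=
  productTest_support π τ hπ hτ hτπ hπτ c₁ c₂ U h₁ h₂ hU p q hp hq (by norm_num) (by norm_num)

end Summit.QuantumAdvantage.QuantumAdvantage.Theorems.NearExactIsExact.Negative.ProductTest
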